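import Literature.Analysis.FluidPDE.PeriodicGalileanNonuniqueness
import HarnessLib

/-!
# Accelerated-frame "blow-up" is compatible with global regularity of the same periodic data
# (Tao 2013, §3, the Galilean symmetry; §1 after Prop. 1.7)

Literature file (topic `Analysis/FluidPDE`; all statements are theorems), companion of
`PeriodicGalileanNonuniqueness.lean`. Source: T. Tao, Anal. PDE 6 (2013) 25–107 =
arXiv:1108.1165 [Tao2013Localisation], §3 eq. (galilean) (the Galilean symmetry
`ũ(t,x) = u(t, x − ∫₀ᵗ v) + v(t)`, `p̃(t,x) = p(t, x − ∫₀ᵗ v) − x · v′(t)`, "valid for any smooth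
function `v : ℝ → ℝ³` … preserves periodicity (recall here that in our definition of a periodic
solution, the pressure was not required to be periodic)") and §1 after Prop. 1.7 ("the technical
loophole of non-periodic pressure"); C. Fefferman's Clay text [FeffermanClay2006], statements
(B)/(D), condition (10) as printed (periodicity of `u` only) and the errata page of the CMI
offprint (`p` periodic too).

## What is formalised

The Galilean image of the REST STATE `(u, p) = (0, 0)` in a frame whose speed blows up at time
`a`: for every viscosity `ν`, every `a` and `w : E`,
`u(t, y) = −(1/(a−t) − 1/a) w`, `p(t, y) = (a−t)⁻² ⟪w, y⟫`
* `isClassicalNSSolutionOn_acceleratedRest` — is a classical solution of the unforced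
  Navier–Stokes system on `E × [0, a)` (tree predicate `IsClassicalNSSolutionOn (Ico 0 a)`), with
  datum `0` and spatially constant — hence `ℤ^ι`-periodic — velocity, and a pressure that is NOT
  periodic (linear in `y`);
* `tendsto_norm_acceleratedRest` — `‖u(t, y)‖ → ∞` as `t → a⁻` (`w ≠ 0`);
* `IsSmoothOnHalfSpace.not_tendsto_norm_atTop` — no field smooth on `E × [0,∞)` (Fefferman's
  (11)) does that, so `(u, p)` has no continuation to a solution smooth on `E × [0,∞)`;
* **`exists_periodic_nonContinuable_and_global`** — packaging: for every `ν`, `a > 0` and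
  nonempty `ι` there is a classical `u`-periodic solution on `ℝ^ι × [0,a)` with datum `0` that
  cannot be continued to `[0,∞)`, while the same data (`u₀ = 0`, `f = 0`, both of Clay class (8),
  (9)) have a global smooth solution with `u` AND `p` periodic (the rest state). So in the printed
  class (10) a statement of the shape "there exist periodic data and a smooth periodic solution
  that cannot be smoothly continued to `[0,∞)`" holds trivially and coexists with (B)-type
  solvability of the same data; it is not a statement of type (D) (which negates the EXISTENCE of
  a global smooth solution), and in the CMI-errata class the accelerated frames are not
  admissible at all (`isLatticePeriodic_galileanBoost_pressure_iff`).

## References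

* [Tao2013Localisation] T. Tao, Anal. PDE 6 (2013) 25–107, arXiv:1108.1165, §1 (after
  Prop. 1.7), §3 eq. (galilean).
* [FeffermanClay2006] C. L. Fefferman, Existence and smoothness of the Navier–Stokes equation, CMI
  (2000/2006): (B), (D), (8)–(11), errata page.
-/

noncomputable section

open Set Function Filter InnerProductSpace
open scoped ContDiff RealInnerProductSpace Topology Laplacian

namespace Literature.Analysis.FluidPDE

section HalfSpace

variable {E : Type*} [NormedAddCommGroup E] [InnerProductSpace ℝ E]

/-- **No field smooth on `E × [0,∞)` blows up at a finite time**: if `w` is smooth on the closed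
half-space then `t ↦ ‖w(t, x)‖` does not tend to `∞` as `t → a⁻`, `a > 0` (it is continuous at
`(a, x)`). Used to turn "becomes infinite as `t → a⁻`" into "has no smooth continuation to
`[0,∞)`": a pair smooth on the CLOSED half-space in the sense of Fefferman's (6)/(11),
`p, u ∈ C^∞(ℝⁿ × [0,∞))`, has no finite blow-up time. [cite: FeffermanClay2006, eqs. (6) (11)] -/
theorem IsSmoothOnHalfSpace.not_tendsto_norm_atTop {F : Type*} [NormedAddCommGroup F]
    [NormedSpace ℝ F] {w : ℝ → E → F} (hw : IsSmoothOnHalfSpace w) {a : ℝ} (ha : 0 < a) (x : E) :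
    ¬ Tendsto (fun t => ‖w t x‖) (𝓝[<] a) atTop := by
  intro hlim
  have hcont : ContinuousWithinAt (fun t => ‖w t x‖) (Ici 0) a := by
    have h1 : ContinuousOn (uncurry w) (Ici (0 : ℝ) ×ˢ univ) := hw.continuousOn
    have h2 : ContinuousWithinAt (uncurry w) (Ici (0 : ℝ) ×ˢ univ) ((fun t : ℝ => (t, x)) a) :=
      h1 (a, x) ⟨ha.le, mem_univ _⟩
    have h3 : ContinuousWithinAt (fun t : ℝ => (t, x)) (Ici 0) a :=
      (continuous_id.prodMk continuous_const).continuousWithinAt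
    exact (ContinuousWithinAt.comp (f := fun t : ℝ => (t, x)) (x := a) h2 h3
      fun t ht => ⟨ht, mem_univ _⟩).norm
  haveI : (𝓝[Ioo 0 a] a).NeBot := right_nhdsWithin_Ioo_neBot ha
  have hsub1 : 𝓝[Ioo 0 a] a ≤ 𝓝[Ici 0] a := nhdsWithin_mono a fun t ht => ht.1.le
  have hsub2 : 𝓝[Ioo 0 a] a ≤ 𝓝[<] a := nhdsWithin_mono a fun t ht => ht.2
  exact not_tendsto_nhds_of_tendsto_atTop (hlim.mono_left hsub2) _ (hcont.tendsto.mono_left hsub1)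

end HalfSpace

/-! ### Accelerated-frame blow-up is compatible with global regularity of the same data -/

section FrameBlowup

variable {E : Type*} [NormedAddCommGroup E] [InnerProductSpace ℝ E] [FiniteDimensional ℝ E]

/-- The frame speed `ψ(t) = 1/(a−t) − 1/a` has derivative `(a−t)⁻²` away from `t = a`. [folklore] -/
private theorem hasDerivAt_frameSpeed (a : ℝ) {t : ℝ} (ht : t ≠ a) :
    HasDerivAt (fun s : ℝ => 1 / (a - s) - 1 / a) (1 / (a - t) ^ 2) t := by
  have h1 : HasDerivAt (fun s : ℝ => a - s) (-1) t := (hasDerivAt_id' t).const_sub a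
  have h3 : HasDerivAt (fun s : ℝ => (a - s)⁻¹ - a⁻¹) (-(-1) / (a - t) ^ 2) t :=
    (h1.inv (sub_ne_zero.2 (Ne.symm ht))).sub_const a⁻¹
  simp only [one_div]
  exact h3.congr_deriv (by ring)

/-- **The accelerated rest frame on `[0, a)`**: for every viscosity `ν`, `a > 0` and `w : E`,
`u(t, y) = −(1/(a−t) − 1/a) w`, `p(t, y) = (a−t)⁻² ⟪w, y⟫` is a classical solution of the
unforced Navier–Stokes system on `E × [0, a)` (the Galilean image of the rest state `(0, 0)`; the
frame acceleration is balanced by the uniform pressure gradient).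
[cite: Tao2013Localisation, §3 eq. (galilean)] -/
theorem isClassicalNSSolutionOn_acceleratedRest (ν : ℝ) {a : ℝ} (w : E) :
    IsClassicalNSSolutionOn (Ico 0 a) ν 0 (fun t _ => -(1 / (a - t) - 1 / a) • w)
      (fun t y => (1 / (a - t) ^ 2) * ⟪w, y⟫) where
  smooth_velocity := by
    have h : ContDiffOn ℝ ∞ (fun z : ℝ × E => -(1 / (a - z.1) - 1 / a) • w) (Ico 0 a ×ˢ univ) := by
      refine ((ContDiffOn.sub ?_ contDiffOn_const).neg).smul contDiffOn_const
      simp only [one_div]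
      exact (contDiffOn_const.sub contDiff_fst.contDiffOn).inv
        fun z hz => sub_ne_zero.2 (ne_of_gt hz.1.2)
    exact h
  smooth_pressure := by
    have h : ContDiffOn ℝ ∞ (fun z : ℝ × E => (1 / (a - z.1) ^ 2) * ⟪w, z.2⟫) (Ico 0 a ×ˢ univ) := by
      refine ContDiffOn.mul ?_ (contDiff_const.inner ℝ contDiff_snd).contDiffOn
      simp only [one_div]
      exact ((contDiffOn_const.sub contDiff_fst.contDiffOn).pow 2).inv
        fun z hz => pow_ne_zero 2 (sub_ne_zero.2 (ne_of_gt hz.1.2))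
    exact h
  momentum t ht y := by
    have hta : t ≠ a := ne_of_lt ht.2
    -- time derivative within `Ico 0 a`
    have hT : timeDerivWithin (Ico 0 a) (fun s (_ : E) => -(1 / (a - s) - 1 / a) • w) t y =
        -(1 / (a - t) ^ 2) • w := by
      rw [timeDerivWithin_apply]
      exact (((hasDerivAt_frameSpeed a hta).neg).smul_const w).hasDerivWithinAt.derivWithin
        (uniqueDiffOn_Ico 0 a t ht)
    -- convective term and Laplacian of a spatially constant field vanish
    have hC : convect ((fun s (_ : E) => -(1 / (a - s) - 1 / a) • w) t)
        ((fun s (_ : E) => -(1 / (a - s) - 1 / a) • w) t) y = 0 := by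
      simp only [convect_apply]
      rw [fderiv_const_apply]
      simp
    have hL : Δ ((fun s (_ : E) => -(1 / (a - s) - 1 / a) • w) t) y = 0 := by
      show Δ (fun _ : E => -(1 / (a - t) - 1 / a) • w) y = 0
      rw [InnerProductSpace.laplacian_const]
      rfl
    -- pressure gradient
    have hG : gradient ((fun s z => (1 / (a - s) ^ 2) * ⟪w, z⟫) t) y = (1 / (a - t) ^ 2) • w := by
      show gradient (fun z : E => (1 / (a - t) ^ 2) * ⟪w, z⟫) y = _
      have h1 : HasFDerivAt (fun z : E => ⟪w, z⟫) (toDual ℝ E w) y := by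
        have : (fun z : E => ⟪w, z⟫) = toDual ℝ E w := by funext z; rfl
        rw [this]; exact (toDual ℝ E w).hasFDerivAt
      have h2 := h1.const_mul (1 / (a - t) ^ 2)
      unfold gradient
      rw [h2.fderiv, map_smul, LinearIsometryEquiv.symm_apply_apply]
    rw [hT, hC, hL, hG]
    simp
  divFree t _ y := by
    change VectorCalculus.divergence (fun _ : E => -(1 / (a - t) - 1 / a) • w) y = 0
    unfold VectorCalculus.divergence
    rw [fderiv_const_apply]
    simp

omit [FiniteDimensional ℝ E] in
/-- The accelerated rest frame blows up as `t → a⁻` (`w ≠ 0`): `‖u(t, y)‖ → ∞` — the frame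
speed `v(t) = −ξ′(t)` of the Galilean symmetry may be any smooth function on `[0, a)`, in
particular an unbounded one. [cite: Tao2013Localisation, §3 eq. (galilean)] -/
theorem tendsto_norm_acceleratedRest (a : ℝ) {w : E} (hw : w ≠ 0) (y : E) :
    Tendsto (fun t => ‖(fun s (_ : E) => -(1 / (a - s) - 1 / a) • w) t y‖) (𝓝[<] a) atTop := by
  simp only [norm_smul, norm_neg]
  have hw' : 0 < ‖w‖ := norm_pos_iff.2 hw
  refine Tendsto.atTop_mul_const hw' ?_
  -- `1/(a−t) − 1/a → +∞` as `t → a⁻`, hence so does its norm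
  have h1 : Tendsto (fun t : ℝ => a - t) (𝓝[<] a) (𝓝[>] 0) := by
    refine tendsto_nhdsWithin_of_tendsto_nhds_of_eventually_within _ ?_ ?_
    · have : Tendsto (fun t : ℝ => a - t) (𝓝 a) (𝓝 (a - a)) :=
        (continuous_const.sub continuous_id).tendsto a
      rw [sub_self] at this
      exact this.mono_left nhdsWithin_le_nhds
    · filter_upwards [self_mem_nhdsWithin] with t ht
      have ht' : t < a := ht
      exact sub_pos.2 ht'
  have h2 : Tendsto (fun t : ℝ => 1 / (a - t)) (𝓝[<] a) atTop := by
    simpa [one_div, Function.comp_def] using tendsto_inv_nhdsGT_zero.comp h1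
  have h3 : Tendsto (fun t : ℝ => 1 / (a - t) - 1 / a) (𝓝[<] a) atTop :=
    tendsto_atTop_add_const_right _ _ h2
  exact tendsto_norm_atTop_atTop.comp h3

/-- **Accelerated-frame blow-up coexists with global smooth solutions of the same data.** For
every viscosity `ν`, every `a > 0` and every lattice `ℤ^ι` (`ι` nonempty) there are a classical
solution `(u, p)` of the unforced system on `ℝ^ι × [0, a)` with datum `0`, `u(·,t)` periodic (even
constant) for `t ∈ [0,a)`, which has NO continuation `(u', p')` smooth on `ℝ^ι × [0,∞)` solving
(1)–(3) with the same data, AND a global smooth solution of the same data with `u` and `p`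
periodic (the rest state). Hence, in Fefferman's printed class (10) (pressure unconstrained),
"there is a smooth periodic solution that cannot be continued to `[0,∞)`" holds at data for which
(B)-type solvability also holds; it is not a statement of type (D). (Tao 2013: the non-periodic
pressure is a "technical loophole"; the errata page of the CMI text adds `p` periodic.)
[cite: Tao2013Localisation, §1 (after Prop. 1.7), §3 eq. (galilean)] -/
theorem exists_periodic_nonContinuable_and_global {ι : Type*} [Fintype ι] [DecidableEq ι]
    [Nonempty ι] (ν : ℝ) {a : ℝ} (ha : 0 < a) :
    ∃ (u : ℝ → EuclideanSpace ℝ ι → EuclideanSpace ℝ ι) (p : ℝ → EuclideanSpace ℝ ι → ℝ),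
      IsClassicalNSSolutionOn (Ico 0 a) ν 0 u p ∧ u 0 = 0 ∧
        (∀ t ∈ Ico 0 a, IsLatticePeriodic (u t)) ∧
        (∀ y, Tendsto (fun t => ‖u t y‖) (𝓝[<] a) atTop) ∧
        (¬ ∃ (u' : ℝ → EuclideanSpace ℝ ι → EuclideanSpace ℝ ι) (p' : ℝ → EuclideanSpace ℝ ι → ℝ),
            IsSmoothOnHalfSpace u' ∧ IsSmoothOnHalfSpace p' ∧ IsNavierStokesSolution ν 0 0 u' p' ∧
              ∀ t ∈ Ico 0 a, u' t = u t ∧ p' t = p t) ∧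
        ∃ (v : ℝ → EuclideanSpace ℝ ι → EuclideanSpace ℝ ι) (q : ℝ → EuclideanSpace ℝ ι → ℝ),
          IsSmoothOnHalfSpace v ∧ IsSmoothOnHalfSpace q ∧ IsNavierStokesSolution ν 0 0 v q ∧
            ∀ t, 0 ≤ t → IsLatticePeriodic (v t) ∧ IsLatticePeriodic (q t) := by
  obtain ⟨j⟩ := ‹Nonempty ι›
  set w : EuclideanSpace ℝ ι := EuclideanSpace.single j (1 : ℝ) with hw_def
  have hw : w ≠ 0 := by
    intro h
    have := congrArg (fun v : EuclideanSpace ℝ ι => v j) h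
    simp [hw_def] at this
  refine ⟨fun t _ => -(1 / (a - t) - 1 / a) • w, fun t y => (1 / (a - t) ^ 2) * ⟪w, y⟫,
    isClassicalNSSolutionOn_acceleratedRest ν w, ?_, fun t _ => isLatticePeriodic_const _,
    fun y => tendsto_norm_acceleratedRest a hw y, ?_, ?_⟩
  · funext y; simp
  · rintro ⟨u', p', hu', -, -, hagree⟩
    refine hu'.not_tendsto_norm_atTop ha 0 ?_
    refine (tendsto_norm_acceleratedRest a hw (0 : EuclideanSpace ℝ ι)).congr' ?_
    filter_upwards [Ioo_mem_nhdsLT ha] with t ht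
    rw [(hagree t ⟨ht.1.le, ht.2⟩).1]
  · obtain ⟨h1, h2, h3⟩ := isNavierStokesSolution_zero (E := EuclideanSpace ℝ ι) ν
    exact ⟨0, 0, h2, h3, h1, fun t _ => ⟨isLatticePeriodic_const _, isLatticePeriodic_const _⟩⟩

end FrameBlowup

end Literature.Analysis.FluidPDE

end
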